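import Mathlib
import Literature.Geometry.DiscreteGeometry.CrystallographicGroups

/-!
# Discontinuous groups of isometries of `ℝ³`, part 1: linear and translation parts

Helper file for stub `stub_groupStructure` (F) of line `purity_stacking` of the crux
`IsometryAtoms.MinimisingLawsCohesive` (stmt-AtomisticToContinuum-15777): the elementary
structure theory of discontinuous groups `Γ ≤ Isom(ℝ³)` (Bieberbach in dimension three).

This part: every isometry `g` of `E = ℝ³` onto itself is `x ↦ L x + g 0` with
`L = g.toRealLinearIsometryEquiv` (Mazur–Ulam, Mathlib); the map `g ↦ L` is multiplicative, the
translations are exactly the `g` with `L = 1`, conjugating a translation by `g` rotates its vector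
by `L`, and under DISCONTINUITY (`Crystallographic.IsDiscontinuous`) only finitely many `g ∈ Γ`
move the origin by at most `C`; consequently a group whose set of linear parts is finite has
finite subgroups of bounded order.
-/

noncomputable section

open scoped RealInnerProductSpace
open Literature.Geometry.DiscreteGeometry.Crystallographic

namespace Summit.AtomisticToContinuum.Crystallization.Theorems.IsometryAtomsMinimisingLawsCohesive.GroupStructure

/-! ## Linear part and translation part -/

/-- Mazur–Ulam decomposition `g x = L x + g 0`, `L = g.toRealLinearIsometryEquiv`. -/
theorem apply_eq_lin_add (g : (EuclideanSpace ℝ (Fin 3)) ≃ᵢ (EuclideanSpace ℝ (Fin 3))) (x : (EuclideanSpace ℝ (Fin 3))) :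
    g x = g.toRealLinearIsometryEquiv x + g 0 := by
  rw [IsometryEquiv.toRealLinearIsometryEquiv_apply, sub_add_cancel]

/-- Differences are mapped by the linear part: `g x - g y = L (x - y)`. -/
theorem apply_sub_apply (g : (EuclideanSpace ℝ (Fin 3)) ≃ᵢ (EuclideanSpace ℝ (Fin 3))) (x y : (EuclideanSpace ℝ (Fin 3))) :
    g x - g y = g.toRealLinearIsometryEquiv (x - y) := by
  rw [map_sub, IsometryEquiv.toRealLinearIsometryEquiv_apply,
    IsometryEquiv.toRealLinearIsometryEquiv_apply]
  abel

/-- The linear part is multiplicative: `L(g h) = L(g) L(h)`. -/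
theorem lin_mul (g h : (EuclideanSpace ℝ (Fin 3)) ≃ᵢ (EuclideanSpace ℝ (Fin 3))) :
    (g * h).toRealLinearIsometryEquiv = g.toRealLinearIsometryEquiv * h.toRealLinearIsometryEquiv := by
  refine LinearIsometryEquiv.ext fun x => ?_
  have h1 : (g * h).toRealLinearIsometryEquiv x = g (h x) - g (h 0) := by
    rw [IsometryEquiv.toRealLinearIsometryEquiv_apply, IsometryEquiv.coe_mul, Function.comp_apply,
      Function.comp_apply]
  have h2 : (g.toRealLinearIsometryEquiv * h.toRealLinearIsometryEquiv) x = g (h x) - g (h 0) := by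
    rw [LinearIsometryEquiv.coe_mul, Function.comp_apply, IsometryEquiv.toRealLinearIsometryEquiv_apply h,
      ← apply_sub_apply g]
  rw [h1, h2]

/-- The linear part of the identity is the identity. -/
theorem lin_one : (1 : (EuclideanSpace ℝ (Fin 3)) ≃ᵢ (EuclideanSpace ℝ (Fin 3))).toRealLinearIsometryEquiv = 1 := by
  ext x
  simp [IsometryEquiv.toRealLinearIsometryEquiv_apply]

/-- The linear part of the inverse is the inverse of the linear part. -/
theorem lin_inv (g : (EuclideanSpace ℝ (Fin 3)) ≃ᵢ (EuclideanSpace ℝ (Fin 3))) :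
    (g⁻¹).toRealLinearIsometryEquiv = (g.toRealLinearIsometryEquiv)⁻¹ := by
  have h := lin_mul g⁻¹ g
  rw [inv_mul_cancel, lin_one] at h
  exact (eq_inv_of_mul_eq_one_left h.symm)

/-- Translation part of a product: `(g h) 0 = L(g) (h 0) + g 0`. -/
theorem mul_apply_zero (g h : (EuclideanSpace ℝ (Fin 3)) ≃ᵢ (EuclideanSpace ℝ (Fin 3))) :
    (g * h) 0 = g.toRealLinearIsometryEquiv (h 0) + g 0 := by
  rw [IsometryEquiv.coe_mul, Function.comp_apply, apply_eq_lin_add g (h 0)]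

/-- Translation part of the inverse: `g⁻¹ 0 = - L(g)⁻¹ (g 0)`. -/
theorem inv_apply_zero (g : (EuclideanSpace ℝ (Fin 3)) ≃ᵢ (EuclideanSpace ℝ (Fin 3))) :
    g⁻¹ 0 = -((g.toRealLinearIsometryEquiv)⁻¹ (g 0)) := by
  have h := mul_apply_zero g⁻¹ g
  rw [inv_mul_cancel, IsometryEquiv.coe_one, id_eq, lin_inv] at h
  -- `0 = L⁻¹ (g 0) + g⁻¹ 0`
  exact eq_neg_of_add_eq_zero_right h.symm

/-! ## Translations -/

/-- The linear part of a translation is the identity. -/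
theorem lin_addRight (v : (EuclideanSpace ℝ (Fin 3))) : (IsometryEquiv.addRight v).toRealLinearIsometryEquiv = 1 := by
  ext x
  simp [IsometryEquiv.toRealLinearIsometryEquiv_apply, IsometryEquiv.addRight_apply]

/-- A translation moves the origin to its vector. -/
theorem addRight_apply_zero (v : (EuclideanSpace ℝ (Fin 3))) : IsometryEquiv.addRight v (0 : (EuclideanSpace ℝ (Fin 3))) = v := by
  rw [IsometryEquiv.addRight_apply, zero_add]

/-- An isometry with trivial linear part is the translation by `g 0`. -/
theorem eq_addRight_of_lin_eq_one {g : (EuclideanSpace ℝ (Fin 3)) ≃ᵢ (EuclideanSpace ℝ (Fin 3))} (h : g.toRealLinearIsometryEquiv = 1) :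
    g = IsometryEquiv.addRight (g 0) := by
  ext x : 1
  rw [apply_eq_lin_add g x, h, IsometryEquiv.addRight_apply]
  rfl

/-- Translations compose additively. -/
theorem addRight_add (v w : (EuclideanSpace ℝ (Fin 3))) :
    IsometryEquiv.addRight (v + w) = IsometryEquiv.addRight v * IsometryEquiv.addRight w := by
  ext x : 1
  rw [IsometryEquiv.coe_mul, Function.comp_apply, IsometryEquiv.addRight_apply,
    IsometryEquiv.addRight_apply, IsometryEquiv.addRight_apply]
  abel

/-- The translation by `0` is the identity. -/
theorem addRight_zero : IsometryEquiv.addRight (0 : (EuclideanSpace ℝ (Fin 3))) = 1 := by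
  ext x : 1
  rw [IsometryEquiv.addRight_apply, add_zero, IsometryEquiv.coe_one, id_eq]

/-- The inverse of a translation. -/
theorem addRight_inv (v : (EuclideanSpace ℝ (Fin 3))) : (IsometryEquiv.addRight v)⁻¹ = IsometryEquiv.addRight (-v) := by
  rw [eq_comm, eq_inv_iff_mul_eq_one, ← addRight_add, neg_add_cancel, addRight_zero]

/-- Iterated translations. -/
theorem addRight_pow (v : (EuclideanSpace ℝ (Fin 3))) (n : ℕ) :
    IsometryEquiv.addRight v ^ n = IsometryEquiv.addRight ((n : ℝ) • v) := by
  induction n with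
  | zero => rw [pow_zero, Nat.cast_zero, zero_smul, addRight_zero]
  | succ n ih =>
    rw [pow_succ, ih, ← addRight_add, Nat.cast_succ, add_smul, one_smul]

/-- `addRight` is injective. -/
theorem addRight_injective : Function.Injective (IsometryEquiv.addRight : (EuclideanSpace ℝ (Fin 3)) → (EuclideanSpace ℝ (Fin 3)) ≃ᵢ (EuclideanSpace ℝ (Fin 3))) := by
  intro v w h
  have := congrArg (fun g : (EuclideanSpace ℝ (Fin 3)) ≃ᵢ (EuclideanSpace ℝ (Fin 3)) => g 0) h
  simpa [IsometryEquiv.addRight_apply] using this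

/-- A translation of finite order is trivial. -/
theorem eq_zero_of_addRight_pow_eq_one {v : (EuclideanSpace ℝ (Fin 3))} {n : ℕ} (hn : 0 < n)
    (h : IsometryEquiv.addRight v ^ n = 1) : v = 0 := by
  rw [addRight_pow, ← addRight_zero] at h
  have h' := addRight_injective h
  rcases smul_eq_zero.1 h' with h0 | h0
  · exact absurd h0 (by exact_mod_cast hn.ne')
  · exact h0

/-- **Conjugation of a translation**: `g ∘ (· + v) ∘ g⁻¹ = (· + L(g) v)`. -/
theorem conj_addRight (g : (EuclideanSpace ℝ (Fin 3)) ≃ᵢ (EuclideanSpace ℝ (Fin 3))) (v : (EuclideanSpace ℝ (Fin 3))) :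
    g * IsometryEquiv.addRight v * g⁻¹ = IsometryEquiv.addRight (g.toRealLinearIsometryEquiv v) := by
  ext x : 1
  rw [IsometryEquiv.coe_mul, IsometryEquiv.coe_mul, Function.comp_apply, Function.comp_apply,
    IsometryEquiv.addRight_apply, IsometryEquiv.addRight_apply, apply_eq_lin_add g (g⁻¹ x + v),
    map_add, add_right_comm, ← apply_eq_lin_add g (g⁻¹ x)]
  change g (g.symm x) + _ = _
  rw [IsometryEquiv.apply_symm_apply]

/-! ## The translation subgroup of a group of isometries -/

variable (Γ : Subgroup ((EuclideanSpace ℝ (Fin 3)) ≃ᵢ (EuclideanSpace ℝ (Fin 3))))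

/-- Translation vectors are closed under addition. -/
theorem add_mem_translationVectors {v w : (EuclideanSpace ℝ (Fin 3))} (hv : v ∈ translationVectors Γ)
    (hw : w ∈ translationVectors Γ) : v + w ∈ translationVectors Γ := by
  rw [mem_translationVectors_iff] at hv hw ⊢
  rw [addRight_add]
  exact Γ.mul_mem hv hw

/-- Translation vectors are closed under negation. -/
theorem neg_mem_translationVectors {v : (EuclideanSpace ℝ (Fin 3))} (hv : v ∈ translationVectors Γ) :
    -v ∈ translationVectors Γ := by
  rw [mem_translationVectors_iff] at hv ⊢
  rw [← addRight_inv]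
  exact Γ.inv_mem hv

/-- Translation vectors are closed under integer multiples. -/
theorem zsmul_mem_translationVectors {v : (EuclideanSpace ℝ (Fin 3))} (hv : v ∈ translationVectors Γ) (n : ℤ) :
    n • v ∈ translationVectors Γ := by
  induction n using Int.induction_on with
  | zero => rw [zero_smul]; exact zero_mem_translationVectors Γ
  | succ n ih => rw [add_smul, one_smul]; exact add_mem_translationVectors Γ ih hv
  | pred n ih => rw [sub_smul, one_smul, sub_eq_add_neg]; exact
      add_mem_translationVectors Γ ih (neg_mem_translationVectors Γ hv)

/-- **Linear parts of `Γ` preserve the translation vectors of `Γ`** (conjugation). -/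
theorem lin_apply_mem_translationVectors {g : (EuclideanSpace ℝ (Fin 3)) ≃ᵢ (EuclideanSpace ℝ (Fin 3))} (hg : g ∈ Γ) {v : (EuclideanSpace ℝ (Fin 3))}
    (hv : v ∈ translationVectors Γ) : g.toRealLinearIsometryEquiv v ∈ translationVectors Γ := by
  rw [mem_translationVectors_iff] at hv ⊢
  rw [← conj_addRight]
  exact Γ.mul_mem (Γ.mul_mem hg hv) (Γ.inv_mem hg)

/-- Inverse linear parts of `Γ` preserve the translation vectors of `Γ`. -/
theorem lin_symm_apply_mem_translationVectors {g : (EuclideanSpace ℝ (Fin 3)) ≃ᵢ (EuclideanSpace ℝ (Fin 3))} (hg : g ∈ Γ) {v : (EuclideanSpace ℝ (Fin 3))}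
    (hv : v ∈ translationVectors Γ) : g.toRealLinearIsometryEquiv.symm v ∈ translationVectors Γ := by
  have h := lin_apply_mem_translationVectors Γ (Γ.inv_mem hg) hv
  rwa [lin_inv] at h

/-- Two elements of `Γ` with the same linear part differ by a translation of `Γ`:
`g⁻¹ h` is the translation by `L(g)⁻¹ (h 0 - g 0)`, a translation vector of `Γ`. -/
theorem sub_mem_translationVectors_of_lin_eq {g h : (EuclideanSpace ℝ (Fin 3)) ≃ᵢ (EuclideanSpace ℝ (Fin 3))} (hg : g ∈ Γ) (hh : h ∈ Γ)
    (he : g.toRealLinearIsometryEquiv = h.toRealLinearIsometryEquiv) :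
    g⁻¹ * h = IsometryEquiv.addRight ((g⁻¹ * h) 0) ∧ (g⁻¹ * h) 0 ∈ translationVectors Γ := by
  have hlin : (g⁻¹ * h).toRealLinearIsometryEquiv = 1 := by
    rw [lin_mul, lin_inv, he, inv_mul_cancel]
  have heq := eq_addRight_of_lin_eq_one hlin
  refine ⟨heq, ?_⟩
  rw [mem_translationVectors_iff, ← heq]
  exact Γ.mul_mem (Γ.inv_mem hg) hh

/-! ## Discontinuity: finitely many elements with bounded translation part -/

variable {Γ}

/-- Under discontinuity only finitely many `g ∈ Γ` move a given point `p` by at most `C`. -/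
theorem finite_setOf_dist_apply_le (hΓ : IsDiscontinuous Γ) (p : (EuclideanSpace ℝ (Fin 3))) (C : ℝ) :
    {g : (EuclideanSpace ℝ (Fin 3)) ≃ᵢ (EuclideanSpace ℝ (Fin 3)) | g ∈ Γ ∧ dist (g p) p ≤ C}.Finite := by
  refine (hΓ (Metric.closedBall p C) (isCompact_closedBall p C)).subset ?_
  rintro g ⟨hg, hd⟩
  refine ⟨hg, g p, ⟨p, Metric.mem_closedBall_self ?_, rfl⟩, Metric.mem_closedBall.2 hd⟩
  exact dist_nonneg.trans hd

/-- Under discontinuity only finitely many `g ∈ Γ` have translation part of norm at most `C`. -/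
theorem finite_setOf_norm_apply_zero_le (hΓ : IsDiscontinuous Γ) (C : ℝ) :
    {g : (EuclideanSpace ℝ (Fin 3)) ≃ᵢ (EuclideanSpace ℝ (Fin 3)) | g ∈ Γ ∧ ‖g 0‖ ≤ C}.Finite := by
  have h := finite_setOf_dist_apply_le hΓ 0 C
  simpa only [dist_zero_right] using h

/-- Under discontinuity the translation vectors of norm at most `C` form a finite set. -/
theorem finite_translationVectors_inter (hΓ : IsDiscontinuous Γ) (C : ℝ) :
    (translationVectors Γ ∩ Metric.closedBall 0 C).Finite := by
  have hfin := finite_setOf_norm_apply_zero_le hΓ C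
  have hsub : (fun v : (EuclideanSpace ℝ (Fin 3)) => IsometryEquiv.addRight v) '' (translationVectors Γ ∩ Metric.closedBall 0 C)
      ⊆ {g : (EuclideanSpace ℝ (Fin 3)) ≃ᵢ (EuclideanSpace ℝ (Fin 3)) | g ∈ Γ ∧ ‖g 0‖ ≤ C} := by
    rintro _ ⟨v, ⟨hv, hC⟩, rfl⟩
    exact ⟨hv, by rwa [addRight_apply_zero, ← mem_closedBall_zero_iff]⟩
  exact Set.Finite.of_finite_image (hfin.subset hsub) addRight_injective.injOn

/-- Under discontinuity the point stabilisers are finite. -/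
theorem finite_setOf_apply_eq (hΓ : IsDiscontinuous Γ) (p : (EuclideanSpace ℝ (Fin 3))) :
    {g : (EuclideanSpace ℝ (Fin 3)) ≃ᵢ (EuclideanSpace ℝ (Fin 3)) | g ∈ Γ ∧ g p = p}.Finite :=
  (finite_setOf_dist_apply_le hΓ p 0).subset fun g hg => ⟨hg.1, by rw [hg.2, dist_self]⟩

/-! ## Finite subgroups inject into the linear parts -/

/-- In a finite subgroup, elements with equal linear parts are equal (their quotient is a
translation of finite order). -/
theorem eq_of_lin_eq_of_finite {H : Subgroup ((EuclideanSpace ℝ (Fin 3)) ≃ᵢ (EuclideanSpace ℝ (Fin 3)))} [Finite H] {g h : (EuclideanSpace ℝ (Fin 3)) ≃ᵢ (EuclideanSpace ℝ (Fin 3))}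
    (hg : g ∈ H) (hh : h ∈ H) (he : g.toRealLinearIsometryEquiv = h.toRealLinearIsometryEquiv) :
    g = h := by
  obtain ⟨heq, -⟩ := sub_mem_translationVectors_of_lin_eq H hg hh he
  have hmem : g⁻¹ * h ∈ H := H.mul_mem (H.inv_mem hg) hh
  -- the element `g⁻¹ h` of the finite group `H` has finite order
  have hfo : IsOfFinOrder (⟨g⁻¹ * h, hmem⟩ : H) := isOfFinOrder_of_finite _
  obtain ⟨n, hn, hpow⟩ := hfo.exists_pow_eq_one
  have hpow' : (g⁻¹ * h) ^ n = 1 := by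
    have := congrArg (fun x : H => (x : (EuclideanSpace ℝ (Fin 3)) ≃ᵢ (EuclideanSpace ℝ (Fin 3)))) hpow
    simpa using this
  rw [heq] at hpow'
  have h0 := eq_zero_of_addRight_pow_eq_one hn hpow'
  have : g⁻¹ * h = 1 := by rw [heq, h0, addRight_zero]
  exact (inv_mul_eq_one.1 this)

/-- **Bounded finite subgroups from finitely many linear parts**: if the set of linear parts of
`Γ` is finite, every finite subgroup of `Γ` has at most that many elements. -/
theorem exists_bound_of_finite_linParts : ∀ Γ : Subgroup (EuclideanSpace ℝ (Fin 3) ≃ᵢ EuclideanSpace ℝ (Fin 3)), ((fun g : EuclideanSpace ℝ (Fin 3) ≃ᵢ EuclideanSpace ℝ (Fin 3) => g.toRealLinearIsometryEquiv) '' (Γ : Set (EuclideanSpace ℝ (Fin 3) ≃ᵢ EuclideanSpace ℝ (Fin 3)))).Finite → ∃ N : ℕ, ∀ H : Subgroup (EuclideanSpace ℝ (Fin 3) ≃ᵢ EuclideanSpace ℝ (Fin 3)), H ≤ Γ → Finite H → Nat.card H ≤ N := by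
  intro Γ hfin
  haveI : Finite ↥((fun g : (EuclideanSpace ℝ (Fin 3)) ≃ᵢ (EuclideanSpace ℝ (Fin 3)) => g.toRealLinearIsometryEquiv) '' (Γ : Set ((EuclideanSpace ℝ (Fin 3)) ≃ᵢ (EuclideanSpace ℝ (Fin 3))))) :=
    hfin.to_subtype
  refine ⟨Nat.card ↥((fun g : (EuclideanSpace ℝ (Fin 3)) ≃ᵢ (EuclideanSpace ℝ (Fin 3)) => g.toRealLinearIsometryEquiv) '' (Γ : Set ((EuclideanSpace ℝ (Fin 3)) ≃ᵢ (EuclideanSpace ℝ (Fin 3))))),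
    fun H hH hHf => ?_⟩
  haveI := hHf
  let f : H → ↥((fun g : (EuclideanSpace ℝ (Fin 3)) ≃ᵢ (EuclideanSpace ℝ (Fin 3)) => g.toRealLinearIsometryEquiv) '' (Γ : Set ((EuclideanSpace ℝ (Fin 3)) ≃ᵢ (EuclideanSpace ℝ (Fin 3))))) :=
    fun g => ⟨(g : (EuclideanSpace ℝ (Fin 3)) ≃ᵢ (EuclideanSpace ℝ (Fin 3))).toRealLinearIsometryEquiv, ⟨g, hH g.2, rfl⟩⟩
  have hf : Function.Injective f := by
    intro a b hab
    apply Subtype.ext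
    exact eq_of_lin_eq_of_finite a.2 b.2 (congrArg Subtype.val hab)
  exact Nat.card_le_card_of_injective f hf

end Summit.AtomisticToContinuum.Crystallization.Theorems.IsometryAtomsMinimisingLawsCohesive.GroupStructure

end
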